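import Summits.KontsevichZagierPeriods.KontsevichZagierPeriods.Theses.TerasomaMultiplication
import Summits.KontsevichZagierPeriods.KontsevichZagierPeriods.Theses.MotivatedMoves

/-!
# Route TerasomaMultiplication — `Assembly` (item stmt-KontsevichZagierPeriods-14232)

The assembly step shared (verbatim decl) by the routes `KontsevichZagierPeriods/TerasomaMultiplication`
and `KontsevichZagierPeriods/MotivatedMoves`:

  `GammaHodgeSector → CompleteModGammaSector → KontsevichZagierPeriods`.

* `GammaHodgeSector` (Γ-Hodge sector): for every Deligne–Koblitz–Ogus Hodge-type pair — the cube
  representation `ρ = [(0,1)^N, ∏ t_j^(x_j−1)(1−t_j)^(y_j−1)]` and the representation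
  `ρ' = [unit 2k-ball × (0,1)^N', c·k!·∏(…)]`, positive non-integer rational exponents, the
  Hodge-type condition via `Int.fract`, `c` real algebraic, equal values — `KZ.Equivalent ρ ρ'`,
  i.e. `[ρ] − [ρ'] ∈ KZ.relations`.
* `CompleteModGammaSector` (Conjecture 1 for the Γ-enlarged calculus): every additive subgroup
  `H ≥ KZ.relations` of `KZ.FormalRep` containing all those pair differences `[ρ] − [ρ']` contains
  `[r] − [r']` for all rational representations `r`, `r'` (`KZ.IntegralRep.IsRational`) of equal
  value.
* `KontsevichZagierPeriods` (`= Literature.Periods.KZPeriodConjecture`, Kontsevich–Zagier's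
  Conjecture 1 over `Literature.NumberTheory.Transcendental.KZCalculus`): rational `r`, `r'` of
  equal value are KZ-equivalent, `[r] − [r'] ∈ KZ.relations`.

Proof: take `H := KZ.relations` in `CompleteModGammaSector`; `relations ≤ relations` is `le_rfl`,
the Γ-pair clause is `GammaHodgeSector` verbatim (`KZ.Equivalent ρ ρ'` unfolds to
`KZ.of ρ - KZ.of ρ' ∈ KZ.relations`), and the conclusion `KZ.of r - KZ.of r' ∈ KZ.relations` is
`KZ.Equivalent r r'`. Pure logic over the route definitions — the same λ-term as the routes'
deciding theorems `…Theses.TerasomaMultiplication.closes` / `…Theses.MotivatedMoves.closes`, proved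
here from the definitions directly (this file does not cite `closes`). Both antecedents are OPEN
route cruxes; nothing here discharges them.

References: M. Kontsevich, D. Zagier, *Periods* (2001), §1.2, Conjecture 1;
A. Huber, S. Müller-Stach, *Periods and Nori Motives* (2017), §13.1.
-/

namespace Summit.KontsevichZagierPeriods.Theorems.TerasomaMultiplicationAssembly

open Literature.NumberTheory.Transcendental

/-- **Assembly of route TerasomaMultiplication** (settles stmt-KontsevichZagierPeriods-14232):
`GammaHodgeSector → CompleteModGammaSector → KontsevichZagierPeriods`. Given rational integral
representations `r`, `r'` with `r.value = r'.value`, apply `CompleteModGammaSector` to the subgroup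
`H := KZ.relations` (`KZ.relations ≤ H` by `le_rfl`); its hypothesis that `H` contains every
Γ-Hodge pair difference `[ρ] − [ρ']` is exactly `GammaHodgeSector` (`KZ.Equivalent ρ ρ'` means
`[ρ] − [ρ'] ∈ KZ.relations`), and its conclusion `[r] − [r'] ∈ KZ.relations` is
`KZ.Equivalent r r'`. [Kontsevich–Zagier 2001, §1.2, Conjecture 1] [folklore] -/
theorem assembly_proof :
    Summit.KontsevichZagierPeriods.KontsevichZagierPeriods.Theses.TerasomaMultiplication.Assembly := by
  unfold Summit.KontsevichZagierPeriods.KontsevichZagierPeriods.Theses.TerasomaMultiplication.Assembly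
  intro h₁ h₂
  rw [KontsevichZagierPeriods_iff]
  intro n m r r' hr hr' hv
  exact h₂ _ le_rfl (fun N N' k x y x' y' c hx hx' hu hc ρ ρ' hd hi hd' hi' hval =>
    h₁ N N' k x y x' y' c hx hx' hu hc ρ ρ' hd hi hd' hi' hval) r r' hr hr' hv

/-- **Assembly of route MotivatedMoves** (the same item stmt-KontsevichZagierPeriods-14232, whose
decl `Assembly : GammaHodgeSector → CompleteModGammaSector → KontsevichZagierPeriods` route
`MotivatedMoves` files verbatim over its own copies of `GammaHodgeSector` and
`CompleteModGammaSector`, definitionally the same propositions): identical proof — specialise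
`CompleteModGammaSector` to `H := KZ.relations` and feed it `GammaHodgeSector`.
[Kontsevich–Zagier 2001, §1.2, Conjecture 1] [folklore] -/
theorem motivatedMoves_assembly_proof :
    Summit.KontsevichZagierPeriods.KontsevichZagierPeriods.Theses.MotivatedMoves.Assembly := by
  unfold Summit.KontsevichZagierPeriods.KontsevichZagierPeriods.Theses.MotivatedMoves.Assembly
  intro h₁ h₂
  rw [KontsevichZagierPeriods_iff]
  intro n m r r' hr hr' hv
  exact h₂ _ le_rfl (fun N N' k x y x' y' c hx hx' hu hc ρ ρ' hd hi hd' hi' hval =>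
    h₁ N N' k x y x' y' c hx hx' hu hc ρ ρ' hd hi hd' hi' hval) r r' hr hr' hv

end Summit.KontsevichZagierPeriods.Theorems.TerasomaMultiplicationAssembly
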